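import Literature.MathematicalPhysics.QuantumFieldTheory.Balaban1983to89.B8Thm4HypothesesPair

/-!
# `Balaban1983to89.B8Thm4TorusAt` — T. Bałaban, *Spaces of regular gauge field configurations on a lattice and gauge fixing
# conditions*, Commun. Math. Phys. **99** (1985) 75–102 [Balaban1985RegularSpaces] ("B8"), **Theorem 4** (p. 88) ∕ **Theorem 2** (p. 83)
# FOR THE DOMAIN SEQUENCE `Ω_j = T_η`, `j = 0, …, k` — the case p. 77 admits verbatim («Let us notice that we admit the case where some
# domains Ω_j are equal to T_η, for example Ω_j = T_η for j = 0,1,…,l, l ≤ k») — TYPED AS AN INTERFACE on the ℤᵈ carrier read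
# periodically (the torus `T_η` of side `P` fine bonds), companion of the cube-family interface `B8Eq119TwistedAxial.Thm4At` (which
# hard-wires `{Ω_j} := B8Eq131Cubes.cube L a M ρ k`, the admissible family (1.131) of Proposition 6), and the modus ponens AT A PAIR WITH
# EQUAL `k`-TH AVERAGES (`concl_of_thm4TorusAt_pair`, the torus twin of `B8Thm4HypothesesPair.concl_of_thm4At_pair`)

statement-level skeleton of published theorems with citation tags; proofs where landed; nothing here is a claim about the Yang–Mills mass gap

WHY (pub-ymgap Track A, DAG node N16 = NE3, seat `pub-ymgap-dag-n16-b`, census line [N16B-CENSUS + INTERFACE-GAP-1], pub-ymgap INBOX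
2026-08-26T03:39Z).  The in-edge N05 → N16 is [B8] Theorem 2 ∕ Theorem 4 READ AT THE MINIMISER PAIR in the ALL-TORUS geometry (the
END's hypothesis `Spine/NE3/PairLandauB8Avg.PairLandauGaugeB8Avg`, reading (R-a): `Ω_j = T_η` for all `j`, so `Λ_j = ∅` for `j < k` and
`Λ_k = T^{(k)}`; the gauge `u` and the Landau direction live on the torus, i.e. are `(N·Lᵏ)`-periodic on `ℤᵈ`).  The tree's only
concrete-carrier typed Theorem 4, `Thm4At L k η c₁ G a M ρ Reg Restr Concl`, fixes the domain sequence to the cube family (1.131) around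
`a`, whose `Λ′₀ = T ∖ □₁` forces `u = 1` outside `□₁` by (1.29) at `j = 0` — a LOCAL gauge, from which no torus Landau representative
follows.  This file types the torus instance, token for token parallel to `Thm4At`: domains `Ω_j := univ` in `B8Ineq132.InAk`, constraint
sets `torusLam k` (`∅` below `k`, `univ` at `k`) in `B8Eq119TwistedAxial.InAx` ∕ (1.29), (1.66) on every level-`j` bond
(`Cond166T`, the torus twin of `B8Prop6OfThm4.Cond166`), `P`-periodic data, and a `P`-periodic gauge `u` unique among `P`-periodic
`G`-valued gauges.  `Reg ∕ Restr ∕ Concl` stay ABSTRACT exactly as in `Thm4At` (the N05 side instantiates them: `Restr := Restr129 L k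
(torusLam k)`, `Reg := B8Eq133Hypotheses.Reg335Zd …`, `Concl` := (1.37)(1.38)(1.62) on the whole torus).

THE PRINTED TEXT (verbatim).  p. 77: «We consider a sequence of domains Ω₀ ⊃ Ω₁ ⊃ Ω₂ ⊃ … ⊃ Ω_k, Ω_j ⊂ T_η, j = 0,1,…,k, (1.3) … Let us
notice that we admit the case where some domains Ω_j are equal to T_η, for example Ω_j = T_η for j = 0,1,…,l, l ≤ k.»  (1.5)–(1.6):
«Λ_j = Ω_j^{(j)} ∖ Ω_{j+1}^{(j)} … Ω = ⋃_j Bʲ(Λ_j)».  p. 88: «Theorem 4. There exists a constant c₁ such that for arbitrary U₀, U′U₀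
satisfying (1.33), (1.34), (1.66) with α₀ + α₁ ≤ c₁ there exists exactly one gauge transformation u satisfying (1.29) and such that the
conditions (1.37), (1.38), (1.62) hold for the configuration U₁ = U′^{u⁻¹}.»  (1.29) p. 81: «(R̄₀uʲ)(y) = 1 for y ∈ Λ_j, j = 0, 1, …, k»;
(1.66) p. 87: «|Ũ′ʲ − 1| < α₁ on Ω_j^{(j)}, j = 0, 1, …, k».

WHAT THIS FILE TYPES ∕ PROVES (kernel; 3 `def`s WITH BODIES — `torusLam`, `Cond166T`, `Thm4TorusAt` (a hypothesis SHAPE like `Thm4At`,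
asserted for nothing) — and theorems; std axioms; carriers and letters of `B8Eq119TwistedAxial` ∕ `B8Thm4HypothesesPair`):
§1 `torusLam k` (`Λ_j` of the all-torus sequence) with `mem_torusLam_iff`, `torusLam_self`, `torusLam_of_ne`; §2 `Cond166T L k U₀ U′ α₁`
((1.66) at every level-`j` bond, `j ≤ k`) with `cond166T_one_iff`; §3 **`Thm4TorusAt L k P η c₁ G Reg Restr Concl`** — Theorem 4 for
`Ω_j = T_η` (torus of `P` fine bonds per direction, `P = N·Lᵏ` in the consumers); §4 AT A PAIR WITH EQUAL `k`-TH AVERAGES (`Ūᵏ = Ū₀ᵏ`, both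
`G`-valued, (1.7) with `α·L^{−2k}`, `P`-periodic, `P = N·Lᵏ`): `cond166T_pertPair` ((1.66) in the torus binder from
`B8Eq166ConstraintPair.ineq166_pair`), `pertPair_periodic` (the perturbation `U′ = U^{u₀}U₀⁻¹` is periodic, `u₀ = ptw` periodic by
`ptw_periodic`), **`concl_of_thm4TorusAt_pair`** — `Thm4TorusAt` ⟹ its conclusion at the pair from `U₀, U ∈ 𝔄_k(univ, α)` and `Reg U₀`
ALONE (the axial clause (1.34) for `torusLam` and (1.66) being theorems at the pair).
DESK CROSS-REFERENCE (D-0062 desk answer [DESK-ANSWER N16], lit-balaban typer g38, 2026-08-26T03:51Z; stub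
`pub/lit-balaban/lit-balaban-typer/desk-N16Thm4AtSeqStub.lean`, NOT in the tree): the desk's `Thm4AtSeq` is the {Ω_j}-PARAMETRIC twin of
`Thm4At` on `ℤᵈ` (any admissible `Ω`, `Λ`; `Thm4AllTorus := Thm4AtSeq … (fun _ ↦ univ) (LamTop k) …`) WITHOUT periodicity — the
infinite-lattice reading of «Ω_j = T_η», with uniqueness among ALL gauges of `ℤᵈ`.  THE END's reading (R-a) is the TORUS: periodic data, a
periodic gauge, uniqueness among periodic gauges (= the gauge transformations of `T_η`), which is what print states; this file types THAT
instance (periodicity displayed in hypotheses and conclusion), in `Thm4At`'s (1.66)-letter `tavg` so that `B8Eq166ConstraintPair.ineq166_pair`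
discharges it at a pair verbatim.  One owner (pub-ymgap bus): this seat lands the torus instance; the parametric `Thm4AtSeq` stays the desk's.
HONEST SCOPE.  An INTERFACE (hypothesis shape) and a modus ponens; Theorem 4 ∕ Theorem 2 are NOT proved here or anywhere in the tree at a
curved background; nothing is inferred from the manuscript beyond the quoted sentences; the periodic-ℤᵈ reading of `T_η` is the lineage's
(`B8Eq166ConstraintPair.ptw_periodic`, `B12Ineq417Flat.shiftCfg`).
-/

noncomputable section

open scoped BigOperators
open Finset

namespace Literature.MathematicalPhysics.QuantumFieldTheory.Balaban1983to89.B8Thm4TorusAt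

open B7Prop1Explicit B7Prop2Explicit B7AvgGaugeCovariance B8Ineq130 B8Eq115GaugeFixing B8Eq119TwistedAxial B8Ineq132
open B8Eq166ConstraintPair B8Thm4HypothesesPair
open B8Lemma1NonAbelian (mulCfg pert pert_mulCfg)
open B8Prop6OfThm4 (tavg tavg_one)
open B12Ineq417Flat (shiftCfg)

-- `Site` alone would resolve to the torus sites of `Setup.lean`; re-export the `ℤ^d` sites of `B7Prop1Explicit`.
export B7Prop1Explicit (Site)

variable {d : ℕ}

variable {𝔸 : Type*} [NormedRing 𝔸] [NormOneClass 𝔸] [NormedAlgebra ℂ 𝔸] [CompleteSpace 𝔸]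

/-! ## §1 The constraint sets of the all-torus domain sequence -/

/-- **`Λ_j` FOR `Ω_j = T_η`, `j = 0, …, k`** ((1.5) «Λ_j = Ω_j^{(j)} ∖ Ω_{j+1}^{(j)}»): `Λ_j = ∅` for `j ≠ k` and `Λ_k = T^{(k)}` (all
level-`k` sites; on `ℤᵈ` read periodically, `univ`). [cite: Balaban1985RegularSpaces, (1.5)–(1.6) p.77, p.77 («we admit the case where some domains Ω_j are equal to T_η»)] -/
def torusLam (k : ℕ) : ℕ → Set (Site d) := fun j => if j = k then Set.univ else ∅

/-- membership in `torusLam`. [cite: Balaban1985RegularSpaces, (1.5) p.77] -/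
theorem mem_torusLam_iff (k j : ℕ) (y : Site d) : y ∈ torusLam (d := d) k j ↔ j = k := by
  unfold torusLam
  split_ifs with h
  · simp [h]
  · simp [h]

/-- `Λ_k = T^{(k)}`. [cite: Balaban1985RegularSpaces, (1.5) p.77] -/
@[simp] theorem torusLam_self (k : ℕ) : torusLam (d := d) k k = Set.univ := by
  simp [torusLam]

/-- `Λ_j = ∅` for `j ≠ k`. [cite: Balaban1985RegularSpaces, (1.5) p.77] -/
theorem torusLam_of_ne {k j : ℕ} (h : j ≠ k) : torusLam (d := d) k j = ∅ := by
  simp [torusLam, h]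

/-! ## §2 (1.66) on the whole torus -/

omit [NormOneClass 𝔸] in
/-- **(1.66) FOR `Ω_j = T_η`**: «|Ũ′ʲ − 1| < α₁ on Ω_j^{(j)}, j = 0, 1, …, k» with `Ω_j^{(j)} = T^{(j)}` — at EVERY level-`j` bond, `j ≤ k`
(`Ũ′ʲ = B8Prop6OfThm4.tavg L U₀ U′ j`, (1.20)); the torus twin of `B8Prop6OfThm4.Cond166`. [cite: Balaban1985RegularSpaces, (1.66) p.87, (1.20) p.79] -/
def Cond166T (L k : ℕ) (U₀ U' : Site d → Fin d → 𝔸ˣ) (α₁ : ℝ) : Prop :=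
  ∀ j, j ≤ k → ∀ (x : Site d) (ν : Fin d), ‖((tavg L U₀ U' j x ν : 𝔸ˣ) : 𝔸) - 1‖ < α₁

omit [NormOneClass 𝔸] in
/-- (1.66) for the pair `1, U′` on the torus reads `|Ū′ʲ − 1| < α₁` everywhere. [cite: Balaban1985RegularSpaces, (1.66) p.87, (1.133) p.99] -/
theorem cond166T_one_iff (L k : ℕ) (U' : Site d → Fin d → 𝔸ˣ) (α₁ : ℝ) :
    Cond166T L k (1 : Site d → Fin d → 𝔸ˣ) U' α₁ ↔
      ∀ j, j ≤ k → ∀ (x : Site d) (ν : Fin d), ‖((avgIter L U' j x ν : 𝔸ˣ) : 𝔸) - 1‖ < α₁ := by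
  simp only [Cond166T, tavg_one]

/-! ## §3 THE INTERFACE: Theorem 4 for the domain sequence `Ω_j = T_η` -/

omit [NormOneClass 𝔸] in
/-- **INTERFACE (HYPOTHESIS SHAPE) — Theorem 4, p. 88, FOR THE DOMAIN SEQUENCE `Ω_j = T_η`, `j = 0, …, k`** (p. 77, admitted case), the
torus `T_η` read as `P`-periodic data on `ℤᵈ` (`P = N·Lᵏ` fine bonds per direction in the consumers).  For `α₀, α₁ > 0` with `α₀ + α₁ ≤ c₁`
and `P`-periodic `G`-valued `U₀`, `U′`: (1.33) = `U₀ ∈ 𝔄_k({T_η}, α₀)` [`InAk` with every `Ω_j = univ`] ∧ «(3.35) of [4]» [`Reg U₀`,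
abstract]; (1.34) = `U′U₀ ∈ 𝔄_k({T_η}, α₀) ∩ Ax_k(𝔅_k, U₀)` with `𝔅_k` from `Λ_j = torusLam k j` [`InAx L k (torusLam k)`]; (1.66) =
`Cond166T L k U₀ U′ α₁`; CONCLUSION: exactly one `P`-PERIODIC `G`-valued gauge transformation `u` with (1.29) [`Restr U₀ u`, abstract; the
N05 side instantiates `Restr129 L k (torusLam k)`] and (1.37), (1.38), (1.62) for `U₁ = U′^{u⁻¹}` [`Concl α₀ α₁ U₀ U′ u`, abstract].  Token for
token the all-torus twin of `B8Eq119TwistedAxial.Thm4At` (which fixes `{Ω_j}` to the cube family (1.131)); asserted for nothing.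
[cite: Balaban1985RegularSpaces, Thm. 4 p.88, Thm. 2 p.83, (1.33)–(1.34) p.82, (1.66) p.87, (1.29) p.81, p.77 («Ω_j = T_η for j = 0,1,…,l, l ≤ k»)] -/
def Thm4TorusAt (L k : ℕ) (P : ℤ) (η c₁ : ℝ) (G : Subgroup 𝔸ˣ)
    (Reg : (Site d → Fin d → 𝔸ˣ) → Prop)
    (Restr : (Site d → Fin d → 𝔸ˣ) → (Site d → 𝔸ˣ) → Prop)
    (Concl : ℝ → ℝ → (Site d → Fin d → 𝔸ˣ) → (Site d → Fin d → 𝔸ˣ) → (Site d → 𝔸ˣ) → Prop) : Prop :=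
  ∀ ⦃α₀ α₁ : ℝ⦄, 0 < α₀ → 0 < α₁ → α₀ + α₁ ≤ c₁ →
    ∀ U₀ U' : Site d → Fin d → 𝔸ˣ, (∀ x κ, U₀ x κ ∈ G) → (∀ x κ, U' x κ ∈ G) →
      (∀ i : Fin d, shiftCfg (P • e i) U₀ = U₀) → (∀ i : Fin d, shiftCfg (P • e i) U' = U') →
      InAk L k η α₀ (fun _ => Set.univ) U₀ → Reg U₀ →
      InAk L k η α₀ (fun _ => Set.univ) (U' * U₀) → InAx L k (torusLam k) U₀ (U' * U₀) →
      Cond166T L k U₀ U' α₁ →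
      ∃ u : Site d → 𝔸ˣ, ((∀ x, u x ∈ G) ∧ (∀ (x : Site d) (i : Fin d), u (x + P • e i) = u x) ∧ Restr U₀ u ∧ Concl α₀ α₁ U₀ U' u) ∧
        ∀ u' : Site d → 𝔸ˣ, (∀ x, u' x ∈ G) → (∀ (x : Site d) (i : Fin d), u' (x + P • e i) = u' x) → Restr U₀ u' →
          Concl α₀ α₁ U₀ U' u' → u' = u

/-! ## §4 Theorem 4 (torus geometry) APPLIES at a pair with equal `k`-th averages -/

omit [NormOneClass 𝔸] [NormedAlgebra ℂ 𝔸] [CompleteSpace 𝔸] in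
/-- A pointwise product of `v`-invariant configurations is `v`-invariant. [folklore] -/
private theorem shiftCfg_mul (v : Site d) (U V : Site d → Fin d → 𝔸ˣ) : shiftCfg v (U * V) = shiftCfg v U * shiftCfg v V := rfl

omit [NormOneClass 𝔸] [NormedAlgebra ℂ 𝔸] [CompleteSpace 𝔸] in
/-- A pointwise inverse of a `v`-invariant configuration is `v`-invariant. [folklore] -/
private theorem shiftCfg_inv (v : Site d) (U : Site d → Fin d → 𝔸ˣ) : shiftCfg v U⁻¹ = (shiftCfg v U)⁻¹ := rfl

omit [NormOneClass 𝔸] [NormedAlgebra ℂ 𝔸] [CompleteSpace 𝔸] in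
/-- The gauge action of a `v`-periodic gauge on a `v`-invariant configuration is `v`-invariant. [cite: Balaban1985Averaging, (8) p.18] -/
theorem shiftCfg_gaugeAct {v : Site d} {u : Site d → 𝔸ˣ} {U : Site d → Fin d → 𝔸ˣ} (hu : ∀ x, u (x + v) = u x) (hU : shiftCfg v U = U) :
    shiftCfg v (gaugeAct u U) = gaugeAct u U := by
  funext x κ
  have hUx : U (x + v) κ = U x κ := by
    have := congrFun (congrFun hU x) κ
    simpa [shiftCfg] using this
  simp only [shiftCfg, gaugeAct, hu, hUx, add_right_comm x v (e κ)]

omit [NormOneClass 𝔸] in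
/-- **THE PERTURBATION OF THE PAIR IS PERIODIC**: for `N·Lᵏ`-periodic `U₀`, `U` (`L ≥ 1`) the pinned gauge `u₀ = ptw L U₀ U k` is periodic
(`ptw_periodic`), hence so is `U′ = U^{u₀}·U₀⁻¹`. [cite: Balaban1985RegularSpaces, (1.16) p.78, (1.3) p.77] -/
theorem pertPair_periodic {L : ℕ} (hL : 1 ≤ L) (N k : ℕ) {U₀ U : Site d → Fin d → 𝔸ˣ}
    (hU₀ : ∀ i : Fin d, shiftCfg (((N * L ^ k : ℕ) : ℤ) • e i) U₀ = U₀)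
    (hU : ∀ i : Fin d, shiftCfg (((N * L ^ k : ℕ) : ℤ) • e i) U = U) (i : Fin d) :
    shiftCfg (((N * L ^ k : ℕ) : ℤ) • e i) (pert (gaugeAct (ptw L U₀ U k) U) U₀) = pert (gaugeAct (ptw L U₀ U k) U) U₀ := by
  have hg : shiftCfg (((N * L ^ k : ℕ) : ℤ) • e i) (gaugeAct (ptw L U₀ U k) U) = gaugeAct (ptw L U₀ U k) U :=
    shiftCfg_gaugeAct (fun x => ptw_periodic hL N k hU₀ hU x i) (hU i)
  funext x κ
  have h1 := congrFun (congrFun hg x) κ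
  have h2 := congrFun (congrFun (hU₀ i) x) κ
  simp only [shiftCfg] at h1 h2
  simp only [shiftCfg, pert, h1, h2]

/-- **(1.66) IN THE TORUS BINDER AT THE PAIR**: for `U₀`, `U` `G`-valued with (1.7) and EQUAL `k`-th averages, `Cond166T L k U₀ U′ (11d²α)` —
`|Ũ′ʲ − 1| < 11d²α` at every bond of every level (`B8Eq166ConstraintPair.ineq166_pair`). [cite: Balaban1985RegularSpaces, (1.66) p.87, (1.20) p.79] -/
theorem cond166T_pertPair (L : ℕ) (hL : 2 ≤ L) (hd : 1 ≤ d) {G : Subgroup 𝔸ˣ} (hG : AvgClosed d L G) (k : ℕ)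
    (U₀ U : Site d → Fin d → 𝔸ˣ) (hU₀ : ∀ x κ, U₀ x κ ∈ G) (hU : ∀ x κ, U x κ ∈ G) {α : ℝ} (hα : 0 < α)
    (hα3 : C0 d * α ≤ 1 / 3) (hα2 : 2 * α ≤ c2' d L)
    (h33 : pdev U₀ < α * (((L : ℝ) ^ k)⁻¹) ^ 2) (h34 : pdev U < α * (((L : ℝ) ^ k)⁻¹) ^ 2)
    (hpair : avgIter L U k = avgIter L U₀ k) (hsmall : 11 * (d : ℝ) ^ 2 * α ≤ 1 / 6) :
    Cond166T L k U₀ (pert (gaugeAct (ptw L U₀ U k) U) U₀) (11 * (d : ℝ) ^ 2 * α) := by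
  intro j hj x ν
  have h := ineq166_pair L hL hd hG k U₀ U hU₀ hU hα hα3 hα2 h33 h34 hpair hsmall (k - j) (Nat.sub_le k j) x ν
  rw [show k - (k - j) = j by omega] at h
  have e : tavg L U₀ (pert (gaugeAct (ptw L U₀ U k) U) U₀) j = pert (avgIter L (gaugeAct (ptw L U₀ U k) U) j) (avgIter L U₀ j) := by
    rw [← pert_avgIter, pertPair_mul]
  rw [e]; exact h

/-- **THEOREM 4 (TORUS GEOMETRY) APPLIES AT THE PAIR** (modus ponens; torus twin of `B8Thm4HypothesesPair.concl_of_thm4At_pair`): for an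
`AvgClosed` gauge group `G`, `L ≥ 2`, `d ≥ 1`, `G`-valued `N·Lᵏ`-periodic `U₀`, `U` with (1.7) `sup_p |·(∂p) − 1| < α·L^{−2k}` (`α`
Prop.-1∕2-small, `11d²α ≤ 1∕6`) and EQUAL `k`-th averages `Ūᵏ = Ū₀ᵏ`, if Theorem 4 holds in the form `Thm4TorusAt L k (N·Lᵏ) η c₁ G Reg Restr
Concl` and `α + 11d²α ≤ c₁`, then from `U₀ ∈ 𝔄_k({T_η}, α)`, `Reg U₀` and `U ∈ 𝔄_k({T_η}, α)` ALONE there is exactly one periodic `G`-valued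
`u` with `Restr U₀ u` ((1.29) on `Λ_k = T^{(k)}`) and `Concl α (11d²α) U₀ U′ u`, `U′ = U^{u₀}U₀⁻¹`, `u₀ = ptw L U₀ U k`.
[cite: Balaban1985RegularSpaces, Thm 4 p.88, (1.33)–(1.34) p.82, (1.66) p.87, p.77] -/
theorem concl_of_thm4TorusAt_pair (L : ℕ) (hL : 2 ≤ L) (hd : 1 ≤ d) {G : Subgroup 𝔸ˣ} (hG : AvgClosed d L G) (N k : ℕ)
    {η c₁ : ℝ}
    {Reg : (Site d → Fin d → 𝔸ˣ) → Prop} {Restr : (Site d → Fin d → 𝔸ˣ) → (Site d → 𝔸ˣ) → Prop}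
    {Concl : ℝ → ℝ → (Site d → Fin d → 𝔸ˣ) → (Site d → Fin d → 𝔸ˣ) → (Site d → 𝔸ˣ) → Prop}
    (hThm4 : Thm4TorusAt L k (((N * L ^ k : ℕ) : ℤ)) η c₁ G Reg Restr Concl)
    (U₀ U : Site d → Fin d → 𝔸ˣ) (hU₀ : ∀ x κ, U₀ x κ ∈ G) (hU : ∀ x κ, U x κ ∈ G)
    (hU₀P : ∀ i : Fin d, shiftCfg (((N * L ^ k : ℕ) : ℤ) • e i) U₀ = U₀)
    (hUP : ∀ i : Fin d, shiftCfg (((N * L ^ k : ℕ) : ℤ) • e i) U = U) {α : ℝ} (hα : 0 < α)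
    (hα3 : C0 d * α ≤ 1 / 3) (hα2 : 2 * α ≤ c2' d L)
    (h33 : pdev U₀ < α * (((L : ℝ) ^ k)⁻¹) ^ 2) (h34 : pdev U < α * (((L : ℝ) ^ k)⁻¹) ^ 2)
    (hpair : avgIter L U k = avgIter L U₀ k) (hsmall : 11 * (d : ℝ) ^ 2 * α ≤ 1 / 6) (hc₁ : α + 11 * (d : ℝ) ^ 2 * α ≤ c₁)
    (hA₀ : InAk L k η α (fun _ => Set.univ) U₀) (hReg : Reg U₀) (hA : InAk L k η α (fun _ => Set.univ) U) :
    ∃ u : Site d → 𝔸ˣ,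
      ((∀ x, u x ∈ G) ∧ (∀ (x : Site d) (i : Fin d), u (x + (((N * L ^ k : ℕ) : ℤ)) • e i) = u x) ∧ Restr U₀ u ∧
        Concl α (11 * (d : ℝ) ^ 2 * α) U₀ (pert (gaugeAct (ptw L U₀ U k) U) U₀) u) ∧
      ∀ u' : Site d → 𝔸ˣ, (∀ x, u' x ∈ G) → (∀ (x : Site d) (i : Fin d), u' (x + (((N * L ^ k : ℕ) : ℤ)) • e i) = u' x) →
        Restr U₀ u' → Concl α (11 * (d : ℝ) ^ 2 * α) U₀ (pert (gaugeAct (ptw L U₀ U k) U) U₀) u' → u' = u := by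
  have hL1 : 1 ≤ L := le_trans (by norm_num) hL
  obtain ⟨huG, hUuG, -, -, -, -⟩ := pinnedTwistedFix_global L hL hG k U₀ U hU₀ hU hα hα3 hα2 h33 h34
  have huU : ∀ x, ptw L U₀ U k x ∈ U1 𝔸 := fun x => hG.le_U1 (huG x)
  have hα₁ : 0 < 11 * (d : ℝ) ^ 2 * α := by
    have : (1 : ℝ) ≤ d := by exact_mod_cast hd
    positivity
  exact hThm4 hα hα₁ hc₁ U₀ (pert (gaugeAct (ptw L U₀ U k) U) U₀) hU₀ (pertPair_mem hU₀ hUuG) hU₀P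
    (pertPair_periodic hL1 N k hU₀P hUP) hA₀ hReg
    ((inAk_pertPair_iff L k η α _ huU).2 hA)
    (inAx_pertPair L hL hG k U₀ U hU₀ hU hα hα3 hα2 h33 h34 _)
    (cond166T_pertPair L hL hd hG k U₀ U hU₀ hU hα hα3 hα2 h33 h34 hpair hsmall)

end Literature.MathematicalPhysics.QuantumFieldTheory.Balaban1983to89.B8Thm4TorusAt

end
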